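import Summits.HubbardSuperconductivity.HubbardLadder.Bounds.HighTemperatureNoStiffness
import Summits.HubbardSuperconductivity.HubbardLadder.Bounds.TwistedActivitySmallness
import Literature.Probability.LatticeModels.AnchoredClusterExpansion
import HarnessLib

/-!
# Twist insensitivity of the grand-canonical `t–t'` Hubbard torus at high temperature:
# the cluster-expansion tail, kernel-checked end to end (pub-hubbard BOUNDS, Theorem 12 (i)–(ii)
# with the TREE's Kotecký–Preiss constants)

HONEST FRAMING (cell pub-hubbard): ladder R1–R4 with certified numbers; no claim on H/H₀. This file
is a BOUND FOR A MODEL CLASS (the seam-twisted `t–t'` Hubbard torus at very high temperature); it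
makes no materials claim. LEAN FILING REQUEST #181.6 (bounds g23); imports #181.1
(`HighTemperatureNoStiffness`: the statement node and `hubbardTorusTT'FluxMu`) and #181.5
(`TwistedActivitySmallness`, hence #181.2–#181.4).

## What is proved (0 sorry)

Write `Z_L(θ) = Tr e^{-β(H^{tt'}_L(t',U;θ) - μN)}` for the `L × L` torus (`L ≥ 3`) with the hopping
across ONE seam column multiplied by `e^{±iθ}` (`hubbardTorusTT'FluxMu`, #181.1), and
`s = |β|(2+2|t'|)`. THEOREM (`abs_log_partitionFn_twist_sub_le`): if `s ≤ 1` and `65² e⁶ s ≤ 1/2`, then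
for every `θ`, every `U : ℝ` (both signs) and every `μ : ℝ`,

  `|log Z_L(0) - log Z_L(θ)| ≤ 2 L² e^{-L}`.

COROLLARY (`HighTemperatureNoThermalStiffnessTT'Cluster`, proved): every flux stiffness `ρ_s` of the
grand-canonical free energy (`β ρ_s θ² ≤ log Z(0) - log Z(θ)` on `|θ| ≤ θ₀`) obeys
`ρ_s ≤ 2 L² e^{-L} / (β θ₀²)`, uniformly in `U, μ` — no thermal phase stiffness survives the
thermodynamic limit in this (astronomically hot: `β(2+2|t'|) ≤ 2.9·10⁻⁷`) regime. The same statement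
with the paper's constants (`T ≥ 160(|t|+|t'|)`, bounds.tex Thm 12, node
`HighTemperatureTwistInsensitivityTT'` of #181.1) is NOT proved here: the tree's generic Cauchy /
Kotecký–Preiss bookkeeping (`(2m+1)² e⁶ δ ≤ 1/2`) is much cruder than bounds.tex Lemmas 12.3–12.4.
What this file settles is the STRUCTURE of Theorem 12 (i): every step from the Hamiltonian to the
`L² e^{-L}` tail is kernel-checked.

## The argument (bounds.tex §12, proof of Thm 12 (i))

1. (#181.3–#181.5) `Z_L(θ) = z₀^{L²} Ξ(ρ_θ)`, `ρ_θ = siteActivityC (hubbardBonds (ttGraph L)) β U μ c_θ` a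
   hard-core subset-polymer gas whose activities obey the one-site Kotecký–Preiss bound
   `Σ_{A ∋ x} |ρ_θ(A)| e^{2|A|} ≤ 64 e⁶ s ≤ 1` uniformly in `θ, U, μ`; hence (`isSmallActivity_ttActivity`)
   `ρ_θ` is an `IsSmallActivity · 1` of the tree's `AnchoredClusterExpansion`.
2. (#181.4, winding dichotomy) `ρ_θ(A) = ρ_0(A)` unless `|A| ≥ L`.
3. (this file, generic: `norm_polymerLogZ_sub_le_of_eq_of_card_lt`) for two small activity families on
   the subsets of a finite site set that agree on all polymers with fewer than `R > 0` sites,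
   `|log Ξ(ρ) - log Ξ(ρ')| ≤ 2 |sites| e^{-δR}`: by the tree's anchored difference formula
   (`polymerLogZ_sub_eq_sum_filter`, [KP86] (2)) the difference is the sum of `Φ^T(C;ρ) - Φ^T(C;ρ')`
   over the clusters `C` containing a large polymer; such a cluster passes through some site `x` and
   has `‖C‖ ≥ R`, so a union bound over `x` and the tree's anchored tail estimate
   (`IsSmallActivity.sum_norm_truncatedWeight_anchored_ge_le`, [KP86] (4) with `d = δ|·|`) give the claim.
4. (this file) `exp (log Ξ(ρ_θ)) = Ξ(ρ_θ) = Z_L(θ)/z₀^{L²}` with `Z_L(θ) > 0` (Hermitian Hamiltonian), so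
   `Re (log Ξ(ρ_θ) - log Ξ(ρ_0)) = log Z_L(θ) - log Z_L(0)` and `|Re w| ≤ ‖w‖`.

References: R. Kotecký, D. Preiss, Comm. Math. Phys. 103 (1986) 491, Theorem p. 492 (1)–(4),
Proposition (i) eq. (5) [KoteckyPreiss1986]; D. Ueltschi, J. Stat. Phys. 95 (1999) 693
(arXiv:cond-mat/9810320) §2.3, §3 [Ueltschi1999]; D. J. Scalapino, S. R. White, S. C. Zhang, PRB 47
(1993) 7995 (flux / superfluid weight) [ScalapinoWhiteZhang1993]; Xu et al., Science 384 (2024)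
eadh7691, eq. (1) (the `t–t'` model) [XuEtAl2024].
-/

noncomputable section

namespace Summit.HubbardSuperconductivity.HubbardLadder.Bounds

open Matrix Finset Literature.MathematicalPhysics.QuantumLattice
  Literature.MathematicalPhysics.QuantumFieldTheory Literature.Probability.LatticeModels
open scoped ComplexConjugate ComplexOrder

/-! ### Generic: two small polymer gases agreeing on small polymers -/

section TwoGas

variable {α : Type*} [DecidableEq α] [Fintype α]

/-- **Union bound over anchors.** For small activities, the truncated functionals of the families
`C ⊆ 𝒱` meeting the polymers of `𝒱` with at least `R > 0` sites have total size
`≤ |α| e^{-δR}`: each such family passes through a site of a large member and has `‖C‖ ≥ R`, and the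
anchored tail bound applies at that site. [cite: KoteckyPreiss1986, Theorem p. 492, estimate (4)] -/
theorem sum_norm_truncatedWeight_meeting_large_le {ρ : Finset α → ℂ} {δ : ℝ}
    (h : IsSmallActivity ρ δ) (𝒱 : Finset (Finset α)) {R : ℝ} (hR : 0 < R) :
    ∑ C ∈ 𝒱.powerset with (C ∩ (𝒱.filter fun A => R ≤ (A.card : ℝ))).Nonempty,
        ‖truncatedWeight polyInc ρ C‖ ≤ Fintype.card α * Real.exp (-(δ * R)) := by
  have hcover : ∀ C ∈ 𝒱.powerset.filter
      (fun C => (C ∩ (𝒱.filter fun A => R ≤ (A.card : ℝ))).Nonempty),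
      ∃ x : α, x ∈ clusterSupp C ∧ R ≤ ∑ A ∈ C, (A.card : ℝ) := by
    intro C hC
    obtain ⟨A, hA⟩ := (Finset.mem_filter.1 hC).2
    rw [Finset.mem_inter] at hA
    have hRA : R ≤ (A.card : ℝ) := (Finset.mem_filter.1 hA.2).2
    have hAne : A.Nonempty := by
      rw [← Finset.card_pos]
      exact_mod_cast hR.trans_le hRA
    obtain ⟨x, hx⟩ := hAne
    refine ⟨x, mem_clusterSupp.2 ⟨A, hA.1, hx⟩, hRA.trans ?_⟩
    exact Finset.single_le_sum (f := fun A : Finset α => (A.card : ℝ)) (fun _ _ => Nat.cast_nonneg _) hA.1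
  calc ∑ C ∈ 𝒱.powerset with (C ∩ (𝒱.filter fun A => R ≤ (A.card : ℝ))).Nonempty,
        ‖truncatedWeight polyInc ρ C‖
      ≤ ∑ C ∈ 𝒱.powerset with (C ∩ (𝒱.filter fun A => R ≤ (A.card : ℝ))).Nonempty,
          ∑ x ∈ (Finset.univ : Finset α) with (x ∈ clusterSupp C ∧ R ≤ ∑ A ∈ C, (A.card : ℝ)),
            ‖truncatedWeight polyInc ρ C‖ := by
        refine Finset.sum_le_sum fun C hC => ?_
        rw [Finset.sum_const, nsmul_eq_mul]
        obtain ⟨x, hx⟩ := hcover C hC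
        have hmem : x ∈ (Finset.univ : Finset α).filter
            (fun x => x ∈ clusterSupp C ∧ R ≤ ∑ A ∈ C, (A.card : ℝ)) :=
          Finset.mem_filter.2 ⟨Finset.mem_univ _, hx⟩
        have h1 : (1 : ℝ) ≤ ((Finset.univ : Finset α).filter
            (fun x => x ∈ clusterSupp C ∧ R ≤ ∑ A ∈ C, (A.card : ℝ))).card :=
          Nat.one_le_cast.2 (Finset.card_pos.2 ⟨x, hmem⟩)
        nlinarith [norm_nonneg (truncatedWeight polyInc ρ C)]
    _ = ∑ x ∈ (Finset.univ : Finset α),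
          ∑ C ∈ (𝒱.powerset.filter fun C => (C ∩ (𝒱.filter fun A => R ≤ (A.card : ℝ))).Nonempty)
            with (x ∈ clusterSupp C ∧ R ≤ ∑ A ∈ C, (A.card : ℝ)), ‖truncatedWeight polyInc ρ C‖ := by
        rw [Finset.sum_comm' (t' := (Finset.univ : Finset α))
          (s' := fun x => (𝒱.powerset.filter fun C =>
            (C ∩ (𝒱.filter fun A => R ≤ (A.card : ℝ))).Nonempty).filter
              fun C => x ∈ clusterSupp C ∧ R ≤ ∑ A ∈ C, (A.card : ℝ))]
        intro C x
        simp only [Finset.mem_filter, Finset.mem_univ, true_and, and_true]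
        try tauto
    _ ≤ ∑ x ∈ (Finset.univ : Finset α),
          ∑ C ∈ 𝒱.powerset with (x ∈ clusterSupp C ∧ R ≤ ∑ A ∈ C, (A.card : ℝ)),
            ‖truncatedWeight polyInc ρ C‖ := by
        refine Finset.sum_le_sum fun x _ => Finset.sum_le_sum_of_subset_of_nonneg (fun C hC => ?_)
          fun C _ _ => norm_nonneg _
        simp only [Finset.mem_filter] at hC ⊢
        exact ⟨hC.1.1, hC.2⟩
    _ ≤ ∑ _x ∈ (Finset.univ : Finset α), Real.exp (-(δ * R)) :=
        Finset.sum_le_sum fun x _ => h.sum_norm_truncatedWeight_anchored_ge_le x 𝒱.powerset R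
    _ = Fintype.card α * Real.exp (-(δ * R)) := by
        rw [Finset.sum_const, nsmul_eq_mul, Finset.card_univ]

/-- **Two small polymer gases that agree on small polymers have close pressures.** If `ρ, ρ'` are
small activities (one-site Kotecký–Preiss form with rate `δ`) on the subsets of a finite site set and
`ρ A = ρ' A` for every polymer `A` of the volume `𝒱` with fewer than `R > 0` sites, then
`|log Ξ_𝒱(ρ) - log Ξ_𝒱(ρ')| ≤ 2 |α| e^{-δR}` (Kotecký–Preiss logarithms). [cite: KoteckyPreiss1986, Theorem p. 492 (2), (4) and Proposition (i)] -/
theorem norm_polymerLogZ_sub_le_of_eq_of_card_lt {ρ ρ' : Finset α → ℂ} {δ : ℝ}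
    (h : IsSmallActivity ρ δ) (h' : IsSmallActivity ρ' δ) (𝒱 : Finset (Finset α)) {R : ℝ}
    (hR : 0 < R) (hagree : ∀ A ∈ 𝒱, (A.card : ℝ) < R → ρ A = ρ' A) :
    ‖polymerLogZ polyInc ρ 𝒱 - polymerLogZ polyInc ρ' 𝒱‖ ≤
      2 * Fintype.card α * Real.exp (-(δ * R)) := by
  have hT : ∀ γ ∈ 𝒱, γ ∉ (𝒱.filter fun A => R ≤ (A.card : ℝ)) → ρ γ = ρ' γ :=
    fun γ hγ hγT => hagree γ hγ (lt_of_not_ge fun hle => hγT (Finset.mem_filter.2 ⟨hγ, hle⟩))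
  rw [polymerLogZ_sub_eq_sum_filter 𝒱 _ hT]
  calc ‖∑ C ∈ 𝒱.powerset with (C ∩ (𝒱.filter fun A => R ≤ (A.card : ℝ))).Nonempty,
          (truncatedWeight polyInc ρ C - truncatedWeight polyInc ρ' C)‖
      ≤ ∑ C ∈ 𝒱.powerset with (C ∩ (𝒱.filter fun A => R ≤ (A.card : ℝ))).Nonempty,
          ‖truncatedWeight polyInc ρ C - truncatedWeight polyInc ρ' C‖ := norm_sum_le _ _
    _ ≤ ∑ C ∈ 𝒱.powerset with (C ∩ (𝒱.filter fun A => R ≤ (A.card : ℝ))).Nonempty,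
          (‖truncatedWeight polyInc ρ C‖ + ‖truncatedWeight polyInc ρ' C‖) :=
        Finset.sum_le_sum fun C _ => norm_sub_le _ _
    _ = (∑ C ∈ 𝒱.powerset with (C ∩ (𝒱.filter fun A => R ≤ (A.card : ℝ))).Nonempty,
          ‖truncatedWeight polyInc ρ C‖) +
        ∑ C ∈ 𝒱.powerset with (C ∩ (𝒱.filter fun A => R ≤ (A.card : ℝ))).Nonempty,
          ‖truncatedWeight polyInc ρ' C‖ := Finset.sum_add_distrib
    _ ≤ Fintype.card α * Real.exp (-(δ * R)) + Fintype.card α * Real.exp (-(δ * R)) :=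
        add_le_add (sum_norm_truncatedWeight_meeting_large_le h 𝒱 hR)
          (sum_norm_truncatedWeight_meeting_large_le h' 𝒱 hR)
    _ = 2 * Fintype.card α * Real.exp (-(δ * R)) := by ring

/-- If `exp w` is a positive real `r`, then `Re w = log r`. [folklore] -/
theorem re_eq_log_of_exp_eq {w : ℂ} {r : ℝ} (hr : 0 < r) (h : Complex.exp w = r) :
    w.re = Real.log r := by
  have hn := congrArg (fun z : ℂ => ‖z‖) h
  simp only [Complex.norm_exp, Complex.norm_real, Real.norm_of_nonneg hr.le] at hn
  rw [← hn, Real.log_exp]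

end TwoGas

/-! ### The empty polymer carries no activity -/

section Empty

variable {Λ : Type*} [LinearOrder Λ] [Fintype Λ]

/-- `ρ(∅) = 0`: polymers are supports of non-empty connected bond sets. [folklore] -/
theorem siteActivityC_empty (P : Finset (Bond Λ)) (β U μ : ℂ) (c : Bond Λ → ℂ) :
    siteActivityC P β U μ c ∅ = 0 := by
  rw [siteActivityC_apply]
  refine Finset.sum_eq_zero fun X hX => ?_
  obtain ⟨hXP, hXA⟩ := Finset.mem_filter.1 hX
  exact absurd hXA (Finset.nonempty_iff_ne_empty.1
    (cellSupp_nonempty verts_nonempty (mem_connectedCellSets.1 hXP).2.1))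

end Empty

/-! ### The twisted `t–t'` torus -/

section Torus

variable {L : ℕ} [NeZero L]

/-- The polymer activities of the seam-twisted grand-canonical `t–t'` torus (#181.4–#181.5):
`ρ_θ = siteActivityC (hubbardBonds (ttGraph L)) β U μ (ttFluxCoupling L β t' θ)`. -/
def ttActivity (L : ℕ) [NeZero L] (β t' U μ θ : ℝ) : Finset (FermionTorus 2 L) → ℂ :=
  siteActivityC (hubbardBonds (ttGraph L)) (β : ℂ) (U : ℂ) (μ : ℂ) (ttFluxCoupling L β t' θ)

/-- **Smallness**: under `s = |β|(2+2|t'|) ≤ 1`, `65² e⁶ s ≤ 1/2`, the twisted activities are small in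
the one-site Kotecký–Preiss sense with rate `δ = 1`, for every `θ, U, μ`. [this file, from #181.5] -/
theorem isSmallActivity_ttActivity (hL : 3 ≤ L) (β t' U μ θ : ℝ)
    (hs1 : |β| * (2 + 2 * |t'|) ≤ 1)
    (hsmall : (65 : ℝ) ^ 2 * (Real.exp 6 * (|β| * (2 + 2 * |t'|))) ≤ 1 / 2) :
    IsSmallActivity (ttActivity L β t' U μ θ) 1 where
  rho_empty := siteActivityC_empty _ _ _ _ _
  delta_pos := one_pos
  sum_le_one x 𝒜 h𝒜 := by
    have h := sum_norm_siteActivityC_ttFlux_le hL β t' U μ θ hs1 hsmall x 𝒜 h𝒜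
    have hX : 0 ≤ Real.exp 6 * (|β| * (2 + 2 * |t'|)) := by positivity
    have h65 : (65 : ℝ) ^ 2 = 4225 := by norm_num
    rw [h65] at hsmall
    calc ∑ A ∈ 𝒜, ‖ttActivity L β t' U μ θ A‖ * Real.exp ((1 + 1) * (A.card : ℝ))
        = ∑ A ∈ 𝒜, ‖siteActivityC (hubbardBonds (ttGraph L)) (β : ℂ) (U : ℂ) (μ : ℂ)
            (ttFluxCoupling L β t' θ) A‖ * Real.exp (2 * A.card) :=
          Finset.sum_congr rfl fun A _ => by rw [ttActivity, one_add_one_eq_two]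
      _ ≤ 64 * (Real.exp 6 * (|β| * (2 + 2 * |t'|))) := h
      _ ≤ 1 := by nlinarith

/-- **Winding dichotomy** (#181.4): polymers with fewer than `L` sites have the same activity at
twist `θ` and at twist `0`. [this file, from #181.4] -/
theorem ttActivity_eq_of_card_lt (hL : 3 ≤ L) (β t' U μ θ : ℝ) {A : Finset (FermionTorus 2 L)}
    (hA : A.card < L) : ttActivity L β t' U μ θ A = ttActivity L β t' U μ 0 A := by
  rcases siteActivityC_twist_dichotomy hL β t' U μ θ (hubbardBonds (ttGraph L)) A with h | h
  · exact h
  · exact absurd hA (not_lt.2 h)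

/-- **The tail estimate for the Kotecký–Preiss logarithms**:
`‖log Ξ(ρ_θ) - log Ξ(ρ_0)‖ ≤ 2 L² e^{-L}`. [this file] -/
theorem norm_polymerLogZ_ttActivity_sub_le (hL : 3 ≤ L) (β t' U μ θ : ℝ)
    (hs1 : |β| * (2 + 2 * |t'|) ≤ 1)
    (hsmall : (65 : ℝ) ^ 2 * (Real.exp 6 * (|β| * (2 + 2 * |t'|))) ≤ 1 / 2) :
    ‖polymerLogZ polyInc (ttActivity L β t' U μ θ) (Finset.univ : Finset (FermionTorus 2 L)).powerset -
        polymerLogZ polyInc (ttActivity L β t' U μ 0) (Finset.univ : Finset (FermionTorus 2 L)).powerset‖ ≤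
      2 * (L : ℝ) ^ 2 * Real.exp (-(L : ℝ)) := by
  have hL0 : (0 : ℝ) < L := by exact_mod_cast (show 0 < L by omega)
  have h := norm_polymerLogZ_sub_le_of_eq_of_card_lt (isSmallActivity_ttActivity hL β t' U μ θ hs1 hsmall)
    (isSmallActivity_ttActivity hL β t' U μ 0 hs1 hsmall) (Finset.univ : Finset (FermionTorus 2 L)).powerset
    hL0 (fun A _ hA => ttActivity_eq_of_card_lt hL β t' U μ θ (by exact_mod_cast hA))
  have hcard : (Fintype.card (FermionTorus 2 L) : ℝ) = (L : ℝ) ^ 2 := by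
    simp [FermionTorus, Fintype.card_lex]
  rw [hcard, one_mul] at h
  exact h

/-- The grand-canonical twisted Hamiltonian is Hermitian. [folklore] -/
theorem isHermitian_hubbardTorusTT'FluxMu (t' U μ θ : ℝ) :
    (hubbardTorusTT'FluxMu L t' U μ θ).IsHermitian := by
  unfold hubbardTorusTT'FluxMu
  refine (isHermitian_hubbardTorusTT'Flux L t' U θ).sub (isHermitian_ofReal_smul ?_ μ)
  unfold Matrix.IsHermitian totalNumber
  simp only [conjTranspose_sum]
  refine Finset.sum_congr rfl fun x _ => Finset.sum_congr rfl fun σ _ => ?_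
  unfold numberOp creation
  rw [conjTranspose_mul, conjTranspose_conjTranspose]

/-- `Z_L(θ)` has positive real part (and is real). [folklore] -/
theorem partitionFn_hubbardTorusTT'FluxMu_re_pos (β t' U μ θ : ℝ) :
    0 < (partitionFn β (hubbardTorusTT'FluxMu L t' U μ θ)).re :=
  partitionFn_re_pos (isHermitian_hubbardTorusTT'FluxMu t' U μ θ) β

/-- **Polymer representation** (#181.5): `Z_L(θ) = z₀^{|Λ_L|} Ξ(ρ_θ)`. [this file, from #181.5] -/
theorem partitionFn_hubbardTorusTT'FluxMu_eq_mul (hL : 3 ≤ L) (β t' U μ θ : ℝ) :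
    partitionFn β (hubbardTorusTT'FluxMu L t' U μ θ) =
      atomicPartitionFn (β : ℂ) (U : ℂ) (μ : ℂ) ^ Fintype.card (FermionTorus 2 L) *
        polymerPartitionFunction polyInc (ttActivity L β t' U μ θ)
          (Finset.univ : Finset (FermionTorus 2 L)).powerset := by
  unfold hubbardTorusTT'FluxMu ttActivity
  rw [partitionFn_hubbardTorusTT'FluxMu_eq_polymer_ttGraph hL, polymerGasZ]
  -- the `DecidableEq` / `Fintype` instances on the two sides come from different resolution paths
  -- (`LinearOrder Λ` in #181.4 versus direct synthesis here); they agree by `Subsingleton`.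
  congr!

/-- **The Kotecký–Preiss logarithm computes the free energy difference**:
`Re (log Ξ(ρ_θ) - log Ξ(ρ_0)) = log Z_L(θ) - log Z_L(0)`. [this file] -/
theorem re_polymerLogZ_sub_eq_log_sub (hL : 3 ≤ L) (β t' U μ θ : ℝ)
    (hs1 : |β| * (2 + 2 * |t'|) ≤ 1)
    (hsmall : (65 : ℝ) ^ 2 * (Real.exp 6 * (|β| * (2 + 2 * |t'|))) ≤ 1 / 2) :
    (polymerLogZ polyInc (ttActivity L β t' U μ θ) (Finset.univ : Finset (FermionTorus 2 L)).powerset -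
        polymerLogZ polyInc (ttActivity L β t' U μ 0) (Finset.univ : Finset (FermionTorus 2 L)).powerset).re =
      Real.log (partitionFn β (hubbardTorusTT'FluxMu L t' U μ θ)).re -
        Real.log (partitionFn β (hubbardTorusTT'FluxMu L t' U μ 0)).re := by
  have hθpos := partitionFn_hubbardTorusTT'FluxMu_re_pos (L := L) β t' U μ θ
  have h0pos := partitionFn_hubbardTorusTT'FluxMu_re_pos (L := L) β t' U μ 0
  have hθre := partitionFn_eq_re (isHermitian_hubbardTorusTT'FluxMu (L := L) t' U μ θ) β
  have h0re := partitionFn_eq_re (isHermitian_hubbardTorusTT'FluxMu (L := L) t' U μ 0) β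
  have hz : atomicPartitionFn (β : ℂ) (U : ℂ) (μ : ℂ) ^ Fintype.card (FermionTorus 2 L) ≠ 0 :=
    pow_ne_zero _ (atomicPartitionFn_real_ne_zero β U μ)
  have hΞ : ∀ θ' : ℝ, polymerPartitionFunction polyInc (ttActivity L β t' U μ θ')
      (Finset.univ : Finset (FermionTorus 2 L)).powerset =
        partitionFn β (hubbardTorusTT'FluxMu L t' U μ θ') /
          atomicPartitionFn (β : ℂ) (U : ℂ) (μ : ℂ) ^ Fintype.card (FermionTorus 2 L) := fun θ' => by
    rw [eq_div_iff hz, partitionFn_hubbardTorusTT'FluxMu_eq_mul hL, mul_comm]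
  have hexp : Complex.exp (polymerLogZ polyInc (ttActivity L β t' U μ θ)
        (Finset.univ : Finset (FermionTorus 2 L)).powerset -
      polymerLogZ polyInc (ttActivity L β t' U μ 0) (Finset.univ : Finset (FermionTorus 2 L)).powerset) =
      (((partitionFn β (hubbardTorusTT'FluxMu L t' U μ θ)).re /
          (partitionFn β (hubbardTorusTT'FluxMu L t' U μ 0)).re : ℝ) : ℂ) := by
    rw [Complex.exp_sub, (isSmallActivity_ttActivity hL β t' U μ θ hs1 hsmall).exp_polymerLogZ,
      (isSmallActivity_ttActivity hL β t' U μ 0 hs1 hsmall).exp_polymerLogZ, hΞ θ, hΞ 0,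
      div_div_div_cancel_right₀ hz, Complex.ofReal_div, ← hθre, ← h0re]
  rw [re_eq_log_of_exp_eq (div_pos hθpos h0pos) hexp, Real.log_div hθpos.ne' h0pos.ne']

/-- **THEOREM (twist insensitivity at high temperature, tree constants).** For `L ≥ 3`, real
`t', U, μ, β, θ` with `|β|(2+2|t'|) ≤ 1` and `65² e⁶ |β|(2+2|t'|) ≤ 1/2`:
`|log Z_L(0) - log Z_L(θ)| ≤ 2 L² e^{-L}`. [this file] -/
theorem abs_log_partitionFn_twist_sub_le (hL : 3 ≤ L) (t' U μ β θ : ℝ)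
    (hs1 : |β| * (2 + 2 * |t'|) ≤ 1)
    (hsmall : (65 : ℝ) ^ 2 * (Real.exp 6 * (|β| * (2 + 2 * |t'|))) ≤ 1 / 2) :
    |Real.log (partitionFn β (hubbardTorusTT'FluxMu L t' U μ 0)).re -
        Real.log (partitionFn β (hubbardTorusTT'FluxMu L t' U μ θ)).re| ≤
      2 * (L : ℝ) ^ 2 * Real.exp (-(L : ℝ)) := by
  rw [abs_sub_comm, ← re_polymerLogZ_sub_eq_log_sub hL β t' U μ θ hs1 hsmall]
  exact (Complex.abs_re_le_norm _).trans (norm_polymerLogZ_ttActivity_sub_le hL β t' U μ θ hs1 hsmall)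

/-! ### Nodes -/

/-- **Node (bounds.tex Thm 12 (i) with the tree's Kotecký–Preiss constants; PROVED below).** For
`L ≥ 3`, all real `t', U, μ, β` with `s = |β|(2+2|t'|) ≤ 1` and `65² e⁶ s ≤ 1/2`, and every seam twist
`θ`: `|log Re Z(0) - log Re Z(θ)| ≤ 2 L² e^{-L}`, `Z(θ) = partitionFn β (hubbardTorusTT'FluxMu L t' U μ θ)`
— uniformly in `U` (both signs) and `μ`. Same shape as #181.1's `HighTemperatureTwistInsensitivityTT'`
(`a = 1`, `b = 1`) but with a far smaller temperature window than the paper's `T ≥ 160(|t|+|t'|)`.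
[programme node: bounds.tex §12 Thm 12 (i); cites KoteckyPreiss1986 Thm p. 492, Ueltschi1999 §3] -/
@[conjecture] def HighTemperatureTwistInsensitivityTT'Cluster : Prop :=
  ∀ (L : ℕ) [NeZero L], 3 ≤ L → ∀ (t' U μ β : ℝ),
    |β| * (2 + 2 * |t'|) ≤ 1 →
    (65 : ℝ) ^ 2 * (Real.exp 6 * (|β| * (2 + 2 * |t'|))) ≤ 1 / 2 →
    ∀ θ : ℝ,
      |Real.log (partitionFn β (hubbardTorusTT'FluxMu L t' U μ 0)).re -
          Real.log (partitionFn β (hubbardTorusTT'FluxMu L t' U μ θ)).re| ≤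
        2 * (L : ℝ) ^ 2 * Real.exp (-(L : ℝ))

/-- PROOF of the node `HighTemperatureTwistInsensitivityTT'Cluster`. [this file] -/
theorem highTemperatureTwistInsensitivityTT'Cluster_holds : HighTemperatureTwistInsensitivityTT'Cluster :=
  fun _L _ hL t' U μ β hs1 hsmall θ => abs_log_partitionFn_twist_sub_le hL t' U μ β θ hs1 hsmall

/-- **Node (bounds.tex Thm 12 (ii), tree constants; PROVED below): no thermal phase stiffness.**
Under the hypotheses of `HighTemperatureTwistInsensitivityTT'Cluster` with `β > 0`, every flux
stiffness `ρ_s` of the grand-canonical free energy — `β ρ_s θ² ≤ log Re Z(0) - log Re Z(θ)` for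
`|θ| ≤ θ₀`, `θ₀ > 0` — satisfies `ρ_s ≤ 2 L² e^{-L} / (β θ₀²)`, uniformly in `U, μ`; in particular
`ρ_s → 0` as `L → ∞`. [programme node: bounds.tex §12 Thm 12 (ii); cites ScalapinoWhiteZhang1993] -/
@[conjecture] def HighTemperatureNoThermalStiffnessTT'Cluster : Prop :=
  ∀ (L : ℕ) [NeZero L], 3 ≤ L → ∀ (t' U μ β ρs θ₀ : ℝ), 0 < β → 0 < θ₀ →
    |β| * (2 + 2 * |t'|) ≤ 1 →
    (65 : ℝ) ^ 2 * (Real.exp 6 * (|β| * (2 + 2 * |t'|))) ≤ 1 / 2 →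
    (∀ θ : ℝ, |θ| ≤ θ₀ → β * ρs * θ ^ 2 ≤
        Real.log (partitionFn β (hubbardTorusTT'FluxMu L t' U μ 0)).re -
          Real.log (partitionFn β (hubbardTorusTT'FluxMu L t' U μ θ)).re) →
    ρs ≤ 2 * (L : ℝ) ^ 2 * Real.exp (-(L : ℝ)) / (β * θ₀ ^ 2)

/-- PROOF of the node `HighTemperatureNoThermalStiffnessTT'Cluster`: evaluate the stiffness
hypothesis at `θ = θ₀` and divide by `β θ₀² > 0`. [this file] -/
theorem highTemperatureNoThermalStiffnessTT'Cluster_holds : HighTemperatureNoThermalStiffnessTT'Cluster := by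
  intro L _ hL t' U μ β ρs θ₀ hβ hθ₀ hs1 hsmall hstiff
  have hins := abs_log_partitionFn_twist_sub_le hL t' U μ β θ₀ hs1 hsmall
  have hE := hstiff θ₀ (by rw [abs_of_pos hθ₀])
  have hpos : 0 < β * θ₀ ^ 2 := mul_pos hβ (pow_pos hθ₀ 2)
  rw [le_div_iff₀ hpos]
  calc ρs * (β * θ₀ ^ 2) = β * ρs * θ₀ ^ 2 := by ring
    _ ≤ _ := hE
    _ ≤ _ := le_abs_self _
    _ ≤ _ := hins

end Torus

end Summit.HubbardSuperconductivity.HubbardLadder.Bounds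

end
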